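import Summits.NavierStokesRegularity.NavierStokesRegularity.Theorems.SoloRefuteSchatz2025WindJetColumn

/-!
# C171 `Schatz2025` — wind-jet refutation of the local face `Step_M1_local` — part 4/6: the CKN quantities of the wind-jet

Cell `ns-claims` (D-0090), row C171 `Schatz2025` (locator =
the LANDED skeleton `Literature.Claims.NS.Schatz2025`, text of record as cited in its module docstring). Records-grade ADDENDUM
object of ns-claims-refuter-5 g5 (chair 2026-08-27T18:19Z: records only; row #155 adjudicated at the consumed
head `Step_M1`). Target of the chain: the RECORDED local face
`Literature.Claims.NS.Schatz2025.Step_M1_local` (skeleton l.182; (M.1) p.42 l.2, l.36–38 «F(θr) ≤ κ F(r) + C θ³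
for every suitable weak solution on Q_r(z0)», constants `θ ∈ (0,1/8)`, `κ ∈ (0,1)`, `C ≥ 0` FIRST, then every
open region, every suitable weak solution, every centre and radius with `Q_{2r}(z0) ⊆ Q`).
Main theorem (last file of the chain): `Summit.NavierStokesRegularity.NavierStokesRegularity.Theorems.Schatz2025.not_Step_M1_local`.

THIS FILE (4/6): the three CKN quantities of the skeleton (`cknA`, `cknC`, `cknDOsc` of
`Literature.Claims.NS.Schatz2025`, `Ffun = cknA + cknC + cknDOsc`) evaluated on the wind-jet at centre `0`:
`cknDOsc` of the zero pressure vanishes; `cknA 1`, `cknC 1` are bounded ABOVE by explicit polynomials in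
`U, M/a` plus the column term `M³[(π/2 + 2w')/U · (48π²a₂²)⁻¹ + (πw'²)⁻³·2π]`; `cknC θ` is bounded BELOW by
`θ⁻² M³ (48π²a²)⁻¹ (1 − 2e^{−3w²/8a}) (πθ²/2 − 2θw)/U`.

WHAT THIS IS NOT: not a claim about NS regularity or blow-up; not a claim about any author beyond the typed
locator.
-/

-- lint debt (cell convention, SoloRefute files): the Theorems namespace repeats `NavierStokesRegularity`.
set_option linter.dupNamespace false

noncomputable section

open Set Function MeasureTheory Filter TopologicalSpace Metric Real
open scoped Topology ContDiff ENNReal RealInnerProductSpace Laplacian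

namespace Summit.NavierStokesRegularity.NavierStokesRegularity.Theorems.Schatz2025

open Literature.Analysis.FluidPDE Literature.Analysis.UnboundedOperators


/-! ## D. The CKN triple of the wind-jet on `Q_θ(0,0)` and `Q_1(0,0)` -/

/-- `‖u‖² = U² + j²` for the 2½-D field `u = ι(U e₀) + j e_z`. [folklore] -/
theorem norm_sq_windJet (M a U t : ℝ) (x : (EuclideanSpace ℝ (Fin 3))) :
    ‖windJet M a U t x‖ ^ 2 = U ^ 2 + (jet M a U t (projXY x)) ^ 2 := by
  rw [norm_sq_eq_projXY, windJet_apply, map_add, map_smul, projXY_embedXY, projXY_eZ, smul_zero,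
    add_zero, norm_windV, sq_abs]
  congr 1
  simp [embedXY_apply_two, eZ]

/-- The vertical component is dominated by the full speed: `|jet| ≤ ‖windJet‖`. [folklore] -/
theorem abs_jet_le_norm_windJet (M a U t : ℝ) (x : (EuclideanSpace ℝ (Fin 3))) :
    |jet M a U t (projXY x)| ≤ ‖windJet M a U t x‖ :=
  abs_le_of_sq_le_sq (by rw [norm_sq_windJet]; nlinarith) (norm_nonneg _)

/-- `‖windJet‖ ≤ |U| + |jet|`. [folklore] -/
theorem norm_windJet_le (M a U t : ℝ) (x : (EuclideanSpace ℝ (Fin 3))) :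
    ‖windJet M a U t x‖ ≤ |U| + |jet M a U t (projXY x)| := by
  have h := abs_le_of_sq_le_sq (a := ‖windJet M a U t x‖) (b := |U| + |jet M a U t (projXY x)|)
    (by
      rw [norm_sq_windJet]
      nlinarith [abs_nonneg U, abs_nonneg (jet M a U t (projXY x)), sq_abs U,
        sq_abs (jet M a U t (projXY x))])
    (by positivity)
  rwa [abs_of_nonneg (norm_nonneg _)] at h

/-- `ENNReal.ofReal (|jet|^3)` is the column functional times `M³` (after birth). [folklore] -/
theorem ofReal_abs_jet_pow {M : ℝ} (hM : 0 ≤ M) (a U t : ℝ) (y : (EuclideanSpace ℝ (Fin 2))) :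
    ENNReal.ofReal (|jet M a U t y| ^ 3) = ENNReal.ofReal (M ^ 3) * Gcol a U t y := by
  rw [Gcol, ← ENNReal.ofReal_mul (by positivity), ← mul_pow, jet,
    abs_of_nonneg (mul_nonneg hM (heatKernelFwd_nonneg' _))]

/-- Lower bound `‖u‖ₑ³ ≥ M³ G`. [folklore] -/
theorem enorm_windJet_cube_ge {M : ℝ} (hM : 0 ≤ M) (a U t : ℝ) (x : (EuclideanSpace ℝ (Fin 3))) :
    ENNReal.ofReal (M ^ 3) * Gcol a U t (projXY x) ≤ ‖windJet M a U t x‖ₑ ^ (3:ℕ) := by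
  rw [← ofReal_abs_jet_pow hM, ← ofReal_norm, ← ENNReal.ofReal_pow (norm_nonneg _)]
  exact ENNReal.ofReal_le_ofReal
    (pow_le_pow_left₀ (abs_nonneg _) (abs_jet_le_norm_windJet M a U t x) 3)

/-- The column mass of the cubed profile over `Q₁`: clean crossing + far field. [folklore] -/
theorem lintegral_Gcol_Q1_le {a U w' a₂ : ℝ} (hU : 0 < U) (hw : 0 < w') (ha₂ : 0 < a₂)
    (ha₂' : a₂ ≤ a - (1 + w') / U) :
    ∫⁻ q in parabolicCylinder 1 (0 : ℝ × (EuclideanSpace ℝ (Fin 3))), Gcol a U q.1 (projXY q.2) ≤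
      ENNReal.ofReal ((π / 2 + 2 * w') / U) * ENNReal.ofReal ((48 * π ^ 2 * a₂ ^ 2)⁻¹) +
        ENNReal.ofReal ((π * w' ^ 2)⁻¹ ^ 3 * (2 * π)) := by
  rw [lintegral_parabolicCylinder _ (measurable_Gcol_proj a U), one_pow]
  set X : ℝ → ℝ≥0∞ := fun t => ENNReal.ofReal (2 * √(1 ^ 2 - (max (‖t • windV U‖ - w') 0) ^ 2))
    with hX
  set K : ℝ≥0∞ := ENNReal.ofReal ((π * w' ^ 2)⁻¹ ^ 3 * (2 * π)) with hK
  have hinner : ∀ t : ℝ, ∫⁻ x in ball (0:(EuclideanSpace ℝ (Fin 3))) 1, Gcol a U t (projXY x) ≤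
      X t * (∫⁻ y in ball (t • windV U) w', Gcol a U t y) + K := by
    intro t
    have h := lintegral_ball_comp_projXY_le (Gcol a U t) (measurable_Gcol a U t) one_pos
      (t • windV U) (B := ENNReal.ofReal ((π * w' ^ 2)⁻¹ ^ 3)) (fun y hy => Gcol_le_far hw hy)
    have hKe : ENNReal.ofReal ((π * w' ^ 2)⁻¹ ^ 3) * ENNReal.ofReal (2 * 1) *
        volume (ball (0 : (EuclideanSpace ℝ (Fin 2))) 1) = K := by
      rw [hK, EuclideanSpace.volume_ball_fin_two, ENNReal.ofReal_one, one_pow, one_mul, mul_one,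
        ← ENNReal.ofReal_mul (by positivity), ← ENNReal.ofReal_mul (by positivity), mul_assoc]
    rwa [hKe] at h
  have hXD : ∀ t ∈ Ioo (-1:ℝ) 0, X t * (∫⁻ y in ball (t • windV U) w', Gcol a U t y) ≤
      X t * ENNReal.ofReal ((48 * π ^ 2 * a₂ ^ 2)⁻¹) := by
    intro t ht
    rcases le_or_gt t (-(1 + w') / U) with hle | hgt
    · have hX0 : X t = 0 := by
        have htU : 1 + w' ≤ -t * U := by
          have : t * U ≤ -(1 + w') / U * U := mul_le_mul_of_nonneg_right hle hU.le
          rw [div_mul_cancel₀ _ hU.ne'] at this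
          linarith
        have hm : 1 ≤ max (‖t • windV U‖ - w') 0 := by
          rw [norm_time_smul_windV hU ht.2.le]
          exact le_max_of_le_left (by linarith)
        have : 1 ^ 2 - (max (‖t • windV U‖ - w') 0) ^ 2 ≤ 0 := by nlinarith
        rw [hX]
        simp only
        rw [Real.sqrt_eq_zero'.2 this, mul_zero, ENNReal.ofReal_zero]
      rw [hX0, zero_mul, zero_mul]
    · refine mul_le_mul' le_rfl (lintegral_Gcol_ball_le ha₂ ?_ w')
      rw [neg_div] at hgt
      linarith
  calc ∫⁻ t in Ioo (-1:ℝ) 0, ∫⁻ x in ball (0:(EuclideanSpace ℝ (Fin 3))) 1, Gcol a U t (projXY x)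
      ≤ ∫⁻ t in Ioo (-1:ℝ) 0, (X t * ENNReal.ofReal ((48 * π ^ 2 * a₂ ^ 2)⁻¹) + K) :=
        setLIntegral_mono' measurableSet_Ioo fun t ht =>
          (hinner t).trans (add_le_add (hXD t ht) le_rfl)
    _ = (∫⁻ t in Ioo (-1:ℝ) 0, X t) * ENNReal.ofReal ((48 * π ^ 2 * a₂ ^ 2)⁻¹) + K := by
        rw [lintegral_add_right _ measurable_const, lintegral_mul_const' _ _ ENNReal.ofReal_ne_top,
          setLIntegral_const, Real.volume_Ioo, sub_neg_eq_add, zero_add, ENNReal.ofReal_one, mul_one]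
    _ ≤ _ := by
        gcongr
        exact lintegral_chord_up hw.le hU

section OnQ1
variable {M a U t : ℝ} (hM : 0 ≤ M) (ha : 0 < a) (ha1 : a ≤ 1) (hU : 0 < U) (haU : 4 ≤ a * U)
include hM ha ha1 hU haU

/-- On `Q₁(0)` (`t < 0`, `‖x‖ < 1`; standing hypotheses `0 ≤ M`, `0 < a ≤ 1`, `0 < U`, `4 ≤ aU`) the jet is
at most `M a⁻¹` (`heatKernelFwd_col_le`: kernel height bound along the column inside the unit ball). [folklore] -/
theorem abs_jet_le (ht : t < 0) {x : (EuclideanSpace ℝ (Fin 3))} (hx : ‖x‖ < 1) : |jet M a U t (projXY x)| ≤ M * a⁻¹ := by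
  rw [jet, abs_of_nonneg (mul_nonneg hM (heatKernelFwd_nonneg' _))]
  exact mul_le_mul_of_nonneg_left
    (heatKernelFwd_col_le ha ha1 hU haU ht ((norm_projXY_le x).trans_lt hx)) hM

/-- Upper bound `‖u‖ₑ² ≤ U² + M²/a²` on `Q₁`. [folklore] -/
theorem enorm_windJet_sq_le (ht : t < 0) {x : (EuclideanSpace ℝ (Fin 3))} (hx : ‖x‖ < 1) :
    ‖windJet M a U t x‖ₑ ^ 2 ≤ ENNReal.ofReal (U ^ 2 + (M * a⁻¹) ^ 2) := by
  rw [← ofReal_norm, ← ENNReal.ofReal_pow (norm_nonneg _), norm_sq_windJet]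
  refine ENNReal.ofReal_le_ofReal (add_le_add le_rfl ?_)
  have h := abs_jet_le hM ha ha1 hU haU ht hx
  rw [← sq_abs]
  exact pow_le_pow_left₀ (abs_nonneg _) h 2

/-- Upper bound `‖u‖ₑ³ ≤ (U³ + 3U²M/a + 3UM²/a²) + M³ G` on `Q₁`. [folklore] -/
theorem enorm_windJet_cube_le (ht : t < 0) {x : (EuclideanSpace ℝ (Fin 3))} (hx : ‖x‖ < 1) :
    ‖windJet M a U t x‖ₑ ^ (3:ℕ) ≤
      ENNReal.ofReal (U ^ 3 + 3 * U ^ 2 * (M * a⁻¹) + 3 * U * (M * a⁻¹) ^ 2) +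
        ENNReal.ofReal (M ^ 3) * Gcol a U t (projXY x) := by
  rw [← ofReal_abs_jet_pow hM, ← ENNReal.ofReal_add (by positivity) (by positivity), ← ofReal_norm,
    ← ENNReal.ofReal_pow (norm_nonneg _)]
  refine ENNReal.ofReal_le_ofReal ?_
  set j := |jet M a U t (projXY x)| with hj
  have hj0 : 0 ≤ j := abs_nonneg _
  have hjle : j ≤ M * a⁻¹ := abs_jet_le hM ha ha1 hU haU ht hx
  have hn : ‖windJet M a U t x‖ ≤ |U| + j := norm_windJet_le M a U t x
  rw [abs_of_pos hU] at hn
  calc ‖windJet M a U t x‖ ^ 3 ≤ (U + j) ^ 3 := pow_le_pow_left₀ (norm_nonneg _) hn 3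
    _ = U ^ 3 + 3 * U ^ 2 * j + 3 * U * j ^ 2 + j ^ 3 := by ring
    _ ≤ U ^ 3 + 3 * U ^ 2 * (M * a⁻¹) + 3 * U * (M * a⁻¹) ^ 2 + j ^ 3 := by gcongr

/-- `A(1) ≤ (U² + M²/a²)·|B₁|`. [folklore] -/
theorem cknA_windJet_le :
    cknA 1 (0 : ℝ × (EuclideanSpace ℝ (Fin 3))) (windJet M a U) ≤ ENNReal.ofReal ((U ^ 2 + (M * a⁻¹) ^ 2) * (π * 4 / 3)) := by
  rw [cknA]
  refine iSup₂_le fun t ht => ?_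
  simp only [Prod.fst_zero, one_pow, zero_sub, mem_Ioo] at ht
  rw [ENNReal.ofReal_one, inv_one, one_mul, Prod.snd_zero]
  calc ∫⁻ x in ball (0:(EuclideanSpace ℝ (Fin 3))) 1, ‖windJet M a U t x‖ₑ ^ 2
      ≤ ∫⁻ _ in ball (0:(EuclideanSpace ℝ (Fin 3))) 1, ENNReal.ofReal (U ^ 2 + (M * a⁻¹) ^ 2) :=
        setLIntegral_mono' measurableSet_ball fun x hx =>
          enorm_windJet_sq_le hM ha ha1 hU haU ht.2 (mem_ball_zero_iff.1 hx)
    _ = ENNReal.ofReal ((U ^ 2 + (M * a⁻¹) ^ 2) * (π * 4 / 3)) := by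
        rw [setLIntegral_const, EuclideanSpace.volume_ball_fin_three, ENNReal.ofReal_one, one_pow,
          one_mul, ← ENNReal.ofReal_mul (by positivity)]

/-- `C(1) ≤ P₁|B₁| + M³ (crossing + far field)`. [folklore] -/
theorem cknC_windJet_le {w' a₂ : ℝ} (hw : 0 < w') (ha₂ : 0 < a₂) (ha₂' : a₂ ≤ a - (1 + w') / U) :
    cknC 1 (0 : ℝ × (EuclideanSpace ℝ (Fin 3))) (windJet M a U) ≤
      ENNReal.ofReal ((U ^ 3 + 3 * U ^ 2 * (M * a⁻¹) + 3 * U * (M * a⁻¹) ^ 2) * (π * 4 / 3) +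
        M ^ 3 * (((π / 2 + 2 * w') / U) * (48 * π ^ 2 * a₂ ^ 2)⁻¹ + (π * w' ^ 2)⁻¹ ^ 3 * (2 * π))) := by
  set P₁ : ℝ := U ^ 3 + 3 * U ^ 2 * (M * a⁻¹) + 3 * U * (M * a⁻¹) ^ 2 with hP₁
  have hP0 : 0 ≤ P₁ := by rw [hP₁]; positivity
  have hQ : parabolicCylinder 1 (0 : ℝ × (EuclideanSpace ℝ (Fin 3))) = Ioo (-1:ℝ) 0 ×ˢ ball (0:(EuclideanSpace ℝ (Fin 3))) 1 := by
    rw [parabolicCylinder]; simp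
  have hvol : volume (parabolicCylinder 1 (0 : ℝ × (EuclideanSpace ℝ (Fin 3)))) = ENNReal.ofReal (π * 4 / 3) := by
    rw [hQ, Measure.volume_eq_prod, Measure.prod_prod, Real.volume_Ioo,
      EuclideanSpace.volume_ball_fin_three]
    simp
  rw [cknC, ENNReal.ofReal_one, one_pow, inv_one, one_mul]
  calc ∫⁻ q in parabolicCylinder 1 (0 : ℝ × (EuclideanSpace ℝ (Fin 3))), ‖windJet M a U q.1 q.2‖ₑ ^ (3:ℕ)
      ≤ ∫⁻ q in parabolicCylinder 1 (0 : ℝ × (EuclideanSpace ℝ (Fin 3))),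
          (ENNReal.ofReal P₁ + ENNReal.ofReal (M ^ 3) * Gcol a U q.1 (projXY q.2)) :=
        setLIntegral_mono' (isOpen_parabolicCylinder _ _).measurableSet fun q hq => by
          rw [hQ, mem_prod, mem_Ioo, mem_ball_zero_iff] at hq
          exact enorm_windJet_cube_le hM ha ha1 hU haU hq.1.2 hq.2
    _ = ENNReal.ofReal P₁ * volume (parabolicCylinder 1 (0 : ℝ × (EuclideanSpace ℝ (Fin 3)))) +
          ENNReal.ofReal (M ^ 3) * ∫⁻ q in parabolicCylinder 1 (0 : ℝ × (EuclideanSpace ℝ (Fin 3))), Gcol a U q.1 (projXY q.2) := by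
        rw [lintegral_add_left measurable_const, setLIntegral_const,
          lintegral_const_mul' _ _ ENNReal.ofReal_ne_top]
    _ ≤ ENNReal.ofReal P₁ * ENNReal.ofReal (π * 4 / 3) + ENNReal.ofReal (M ^ 3) *
          (ENNReal.ofReal ((π / 2 + 2 * w') / U) * ENNReal.ofReal ((48 * π ^ 2 * a₂ ^ 2)⁻¹) +
            ENNReal.ofReal ((π * w' ^ 2)⁻¹ ^ 3 * (2 * π))) := by
        rw [hvol]
        gcongr
        exact lintegral_Gcol_Q1_le hU hw ha₂ ha₂'
    _ = _ := by
        rw [← ENNReal.ofReal_mul (by positivity), ← ENNReal.ofReal_mul (by positivity),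
          ← ENNReal.ofReal_add (by positivity) (by positivity), ← ENNReal.ofReal_mul (by positivity),
          ← ENNReal.ofReal_add (by positivity) (by positivity)]

end OnQ1

/-- The pressure term of the CKN triple vanishes for the zero pressure. [folklore] -/
theorem cknDOsc_zero_pressure (r : ℝ) (z : ℝ × (EuclideanSpace ℝ (Fin 3))) : cknDOsc r z (fun _ _ => (0:ℝ)) = 0 := by
  simp [cknDOsc, ENNReal.zero_rpow_of_pos]

/-- **Lower bound at scale `θ`**: `C(θ) ≥ θ⁻² M³ · L₀ · (πθ²/2 − 2θw)/U`. [folklore] -/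
theorem cknC_windJet_ge {M a U θ w : ℝ} (hM : 0 ≤ M) (hθ : 0 < θ) (hw : 0 ≤ w) (hU : 0 < U)
    (ha : 0 < a) (hwin : (θ - w) / U ≤ θ ^ 2) (hbirth : (θ - w) / U < a)
    (htail : 2 * exp (-(3 * w ^ 2) / (8 * a)) ≤ 1) :
    ENNReal.ofReal ((θ ^ 2)⁻¹ * (M ^ 3 * ((48 * π ^ 2 * a ^ 2)⁻¹ *
      (1 - 2 * exp (-(3 * w ^ 2) / (8 * a))) * ((π * θ ^ 2 / 2 - 2 * θ * w) / U)))) ≤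
      cknC θ (0 : ℝ × (EuclideanSpace ℝ (Fin 3))) (windJet M a U) := by
  set L : ℝ := (48 * π ^ 2 * a ^ 2)⁻¹ * (1 - 2 * exp (-(3 * w ^ 2) / (8 * a))) with hL
  have hL0 : 0 ≤ L := by rw [hL]; exact mul_nonneg (by positivity) (by linarith)
  rw [cknC, ENNReal.ofReal_mul (by positivity), ENNReal.ofReal_inv_of_pos (by positivity),
    ENNReal.ofReal_pow hθ.le]
  refine mul_le_mul' le_rfl ?_
  rw [ENNReal.ofReal_mul (by positivity)]
  have hIoo : Ioo (-(θ - w) / U) 0 ⊆ Ioo (-θ ^ 2) (0:ℝ) :=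
    Ioo_subset_Ioo (by rw [neg_div]; linarith) le_rfl
  calc ENNReal.ofReal (M ^ 3) * ENNReal.ofReal (L * ((π * θ ^ 2 / 2 - 2 * θ * w) / U))
      ≤ ENNReal.ofReal (M ^ 3) *
          ∫⁻ t in Ioo (-θ ^ 2) 0, ∫⁻ x in ball (0:(EuclideanSpace ℝ (Fin 3))) θ, Gcol a U t (projXY x) := by
        refine mul_le_mul' le_rfl ?_
        calc ENNReal.ofReal (L * ((π * θ ^ 2 / 2 - 2 * θ * w) / U))
            = ENNReal.ofReal L * ENNReal.ofReal ((π * θ ^ 2 / 2 - 2 * θ * w) / U) :=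
              ENNReal.ofReal_mul hL0
          _ ≤ ENNReal.ofReal L * ∫⁻ t in Ioo (-(θ - w) / U) 0,
                ENNReal.ofReal (2 * √(θ ^ 2 - (‖t • windV U‖ + w) ^ 2)) :=
              mul_le_mul' le_rfl (lintegral_chord_low hθ hw hU)
          _ = ∫⁻ t in Ioo (-(θ - w) / U) 0,
                ENNReal.ofReal (2 * √(θ ^ 2 - (‖t • windV U‖ + w) ^ 2)) * ENNReal.ofReal L := by
              rw [mul_comm, lintegral_mul_const' _ _ ENNReal.ofReal_ne_top]
          _ ≤ ∫⁻ t in Ioo (-(θ - w) / U) 0, ∫⁻ x in ball (0:(EuclideanSpace ℝ (Fin 3))) θ, Gcol a U t (projXY x) := by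
              refine setLIntegral_mono' measurableSet_Ioo fun t ht => ?_
              have hta : 0 < t + a := by
                have h1 := ht.1
                rw [neg_div] at h1
                linarith
              calc ENNReal.ofReal (2 * √(θ ^ 2 - (‖t • windV U‖ + w) ^ 2)) * ENNReal.ofReal L
                  ≤ ENNReal.ofReal (2 * √(θ ^ 2 - (‖t • windV U‖ + w) ^ 2)) *
                      ∫⁻ y in ball (t • windV U) w, Gcol a U t y :=
                    mul_le_mul' le_rfl (lintegral_Gcol_ball_ge hta ht.2.le hw htail)
                _ ≤ _ := lintegral_ball_comp_projXY_ge (Gcol a U t) (measurable_Gcol a U t) hθ _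
          _ ≤ _ := lintegral_mono_set hIoo
    _ = ENNReal.ofReal (M ^ 3) *
          ∫⁻ q in parabolicCylinder θ (0 : ℝ × (EuclideanSpace ℝ (Fin 3))), Gcol a U q.1 (projXY q.2) := by
        rw [lintegral_parabolicCylinder _ (measurable_Gcol_proj a U)]
    _ = ∫⁻ q in parabolicCylinder θ (0 : ℝ × (EuclideanSpace ℝ (Fin 3))), ENNReal.ofReal (M ^ 3) * Gcol a U q.1 (projXY q.2) :=
        (lintegral_const_mul' _ _ ENNReal.ofReal_ne_top).symm
    _ ≤ ∫⁻ q in parabolicCylinder θ (0 : ℝ × (EuclideanSpace ℝ (Fin 3))), ‖windJet M a U q.1 q.2‖ₑ ^ (3:ℕ) :=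
        lintegral_mono fun q => enorm_windJet_cube_ge hM a U q.1 q.2

end Summit.NavierStokesRegularity.NavierStokesRegularity.Theorems.Schatz2025
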